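import Summits.ResolutionOfSingularities.ResolutionOfSingularities.Theorems.PurelyInseparableDim4ResConeTTPersist
import Summits.ResolutionOfSingularities.ResolutionOfSingularities.Theorems.PurelyInseparableDim4ResConeSatUnique
import Summits.ResolutionOfSingularities.ResolutionOfSingularities.Theorems.PurelyInseparableDim4ResConeFourWeights
import Summits.ResolutionOfSingularities.ResolutionOfSingularities.Theorems.PurelyInseparableDim4ResConeShadeTwoCorner
import HarnessLib
import HarnessLib.Audit.Tags

/-!
# Purely inseparable four-folds — TT IS REBORN AFTER EVERY SATELLITE STEP, and the D∞ `(5,4)` class is TT at every late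
# `(2,1)`-state (K2(p) lane, SLICE C, TAIL-D `(5,4)` presentation residuals: the TT input of the hN4-D / Φ-line owners;
# file-holder res-dim4-p-5 g5)

[OURS · counted 0 · cell `res-dim4-pi` · K2(p) lane, slice C (desk WORD #182 «p-5 g5 with the hN4-D owners»; bus
2026-08-29 07:38Z offer) · seat p-5 g5.]  Nothing here proves hN4-D, TAIL-D, K2(p)/K2(5), `NoIsolatedTrap p p` or resolution of
singularities in dimension ≥ 4 / char. `p` — NOT proved.  AI kernel work, weaker than expert review.

«TT for the pair `{a, a′}` at time `k`» = the polar kernel `Vtx(k) = resVertex (c k)` has no non-zero vector vanishing at `a`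
and `a′` (res-dim4-p-5 g4's `…ResConeTTPersist`, res-dim4-p-3 g4's `…LightPairKernel`).  On a constant-`(d, e_G = 2)` tail the
direction `D_k` of step `k` lies in `Vtx(k)` ((VT)(i) `chain_direction_mem_resVertex`) and has `D_k (j k) = 1`, so
`Vtx(k) ∩ H_{j k}` is a LINE; by (I2) (`chain_resVertex_step_inf_hyperplane_eq`) it survives to `k + 1`, and a SATELLITE step
`k + 1` (`j (k+1) ≠ j k`, `b (k+1) (j k) = 0`) has its direction `D_{k+1}` on that line (`chain_satellite_direction_eq_smul`).
Hence (§1, every prime `p`, every `d`):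
* **`tt_succ_of_satellite`** / **`tt_of_satellite`** — after a satellite step `k + 1`, NO non-zero kernel vector at `k + 1`
  (resp. `k + 2`) vanishes at both `j k` and `j (k+1)`: TT for the pair `{j k, j (k+1)}` is REBORN, whatever happened before;
* **`inf_hyperplane_eq_span_direction_of_satellite`** — `Vtx(k) ∩ H_{j k} = K ∙ D_{k+1}`: the satellite direction is
  kernel-determined (the datum a virtual `(2)`-step reads).
§2, `p = 5`, `d = 4`, the D∞ branch of W₄ `four_weights_dichotomy` (binder verbatim: one weight-`2` letter, the others `≤ 1`,
`|r| ∈ {2, 3}` from `k₁`):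
* **`dInf_two_visit`** — a `(2)`-state `k + 1 ≥ k₁ + 1` comes from a `(2,1)`-state, its heavy letter is the newborn `j k`, step
  `k + 1` is a SATELLITE of step `k` (W₄ `dInf_pattern`), and the child is the `(2,1)`-state `2e_{j k} + e_{j (k+1)}`;
* **`dInf_three_three_step`** — the bookkeeping of a `(2,1) → (2,1)` step (light letter kept untranslated and not charted,
  heavy letter hit, new pair `{j k, light}`);
* **`dInf_tt_succ`** — TT for the boundary pair passes along a `(2,1) → (2,1)` step (`tt_succ` if the chart is the heavy
  letter, `tt_move` with the frame vector `D_k / b_k(heavy)` if the chart is a free letter);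
* **`dInf_tt_run`**, **`dInf_tt`** — HENCE TT HOLDS AT EVERY `(2,1)`-STATE FROM THE FIRST `(2)`-VISIT ON:
  `∀ v ∈ resVertex (c m), (∀ i, 1 ≤ (c m).r i → v i = 0) → v = 0`; since `(2)`-visits are unbounded (W₄
  `no_four_tail_of_degree_two_budget`), from some `k₂ ≥ k₁` on every `(2,1)`-state is TT — no entry hypothesis, no FT.
Not here: any re-presentation (hN4-D, res-dim4-typ-1 g4 / res-dim4-p-8 g5), any Φ (res-dim4-p-7 g5 et al.).
[cite: CossartJannsenSaito2020, Thm. 3.10(4), Thm. 3.14, Thm. 9.3] [cite: HauserPerlega2019PRIMS, §2 (transform D′ of D)]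
bears_on: LADDER-RESOLUTION:D157-DOOR2 (res-dim4-pi · K2(p) = `RidgeBudget.NoAboveFloorTrap p p` · slice C, TAIL-D `(5,4)` D∞ class).
Supports stmt-ResolutionOfSingularities-16155 (helper).
-/

set_option linter.dupNamespace false -- mandated namespace of this single-conjunct summit

noncomputable section

namespace Summit.ResolutionOfSingularities.ResolutionOfSingularities.Theorems.PIDim4

namespace ResCone

open MvPolynomial Finset
open Literature.AlgebraicGeometry.Resolution
open Literature.AlgebraicGeometry.Resolution.CentreBlowup
open Literature.AlgebraicGeometry.Resolution.Hauser2010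
open Literature.AlgebraicGeometry.Resolution.HauserPerlega2019
open PointBlowup (direction)

variable {K : Type} [Field K]

/-! ## §1 TT is reborn after a satellite step (every `p`, constant-`(d, e_G = 2)` tail) -/

section Satellite

variable (p : ℕ) [Fact p.Prime] [DecidableEq K]

/-- **TT REBORN, one-step form**: on a constant-`(d, e_G = 2)` tail, if step `k + 1` is a satellite of step `k`, then no
non-zero vector of `resVertex (c (k+1))` vanishes at both `j k` and `j (k+1)` (such a vector is an old kernel vector by (I2),
lies on the line `Vtx(k) ∩ H_{j k}` spanned by the satellite direction, whose `j (k+1)`-coordinate is `1`). [OURS]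
[cite: CossartJannsenSaito2020, Thm. 3.10(4), Thm. 3.14, Thm. 9.3] -/
theorem tt_succ_of_satellite {c : ℕ → State K} {j : ℕ → Fin 4} {b : ℕ → Fin 4 → K}
    (hc : ∀ k, IsIsolated p (c k).F ∧ Step0 p (c k) (c (k + 1))) (hw : FreeTail.IsWitnessedChain p c j b)
    (hr0 : ∀ e ∈ (c 0).F.support, (c 0).r ≤ e) (hfloor : ∀ k, ordZero (c k).F ≠ p) {k₀ : ℕ} {d : ℕ∞}
    (hshade : ∀ k, k₀ ≤ k → (c k).shade = d) (he : ∀ k, k₀ ≤ k → Module.finrank K (resVertex (c k)) = 2)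
    {k : ℕ} (hk : k₀ ≤ k) (hsat : FreeTail.IsSatellite j b k) :
    ∀ v ∈ resVertex (c (k + 1)), v (j k) = 0 → v (j (k + 1)) = 0 → v = 0 := by
  intro v hv hvj hvj'
  by_contra hv0
  have hvk : v ∈ resVertex (c k) :=
    (mem_resVertex_iff_of_apply_chart_eq_zero p hc hw hr0 hfloor hshade he hk hvj).mp hv
  exact (chain_satellite_direction_eq_smul p hc hw hr0 hfloor hshade hk hsat (he k hk).le hvk hvj hv0).1 hvj'

/-- **TT REBORN**: on a constant-`(d, e_G = 2)` tail, after a satellite step `k + 1` the kernel at `k + 2` has no non-zero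
vector vanishing at `j k` and `j (k+1)` — TT for the pair `{j k, j (k+1)}` at `k + 2`, with NO hypothesis on the past.
[OURS] [cite: CossartJannsenSaito2020, Thm. 3.10(4), Thm. 3.14, Thm. 9.3] -/
theorem tt_of_satellite {c : ℕ → State K} {j : ℕ → Fin 4} {b : ℕ → Fin 4 → K}
    (hc : ∀ k, IsIsolated p (c k).F ∧ Step0 p (c k) (c (k + 1))) (hw : FreeTail.IsWitnessedChain p c j b)
    (hr0 : ∀ e ∈ (c 0).F.support, (c 0).r ≤ e) (hfloor : ∀ k, ordZero (c k).F ≠ p) {k₀ : ℕ} {d : ℕ∞}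
    (hshade : ∀ k, k₀ ≤ k → (c k).shade = d) (he : ∀ k, k₀ ≤ k → Module.finrank K (resVertex (c k)) = 2)
    {k : ℕ} (hk : k₀ ≤ k) (hsat : FreeTail.IsSatellite j b k) :
    ∀ v ∈ resVertex (c (k + 2)), v (j k) = 0 → v (j (k + 1)) = 0 → v = 0 := by
  intro v hv hvj hvj'
  have hv1 : v ∈ resVertex (c (k + 1)) :=
    (mem_resVertex_iff_of_apply_chart_eq_zero p hc hw hr0 hfloor hshade he (show k₀ ≤ k + 1 by omega) hvj').mp hv
  exact tt_succ_of_satellite p hc hw hr0 hfloor hshade he hk hsat v hv1 hvj hvj'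

/-- **THE SATELLITE DIRECTION IS KERNEL-DETERMINED**: on a constant-`(d, e_G = 2)` tail, at a step `k` followed by a
satellite step, `resVertex (c k) ⊓ H_{j k}` is the line spanned by the direction of step `k + 1`. [OURS]
[cite: CossartJannsenSaito2020, Thm. 3.10(4), Thm. 3.14, Thm. 9.3] -/
theorem inf_hyperplane_eq_span_direction_of_satellite {c : ℕ → State K} {j : ℕ → Fin 4} {b : ℕ → Fin 4 → K}
    (hc : ∀ k, IsIsolated p (c k).F ∧ Step0 p (c k) (c (k + 1))) (hw : FreeTail.IsWitnessedChain p c j b)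
    (hr0 : ∀ e ∈ (c 0).F.support, (c 0).r ≤ e) (hfloor : ∀ k, ordZero (c k).F ≠ p) {k₀ : ℕ} {d : ℕ∞}
    (hshade : ∀ k, k₀ ≤ k → (c k).shade = d) (he : ∀ k, k₀ ≤ k → Module.finrank K (resVertex (c k)) = 2)
    {k : ℕ} (hk : k₀ ≤ k) (hsat : FreeTail.IsSatellite j b k) :
    resVertex (c k) ⊓ hyperplane (j k) = K ∙ direction (j (k + 1)) (b (k + 1)) := by
  apply le_antisymm
  · intro u hu
    obtain ⟨huV, huH⟩ := Submodule.mem_inf.mp hu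
    rw [mem_hyperplane] at huH
    by_cases hu0 : u = 0
    · rw [hu0]; exact Submodule.zero_mem _
    obtain ⟨hne, hdir⟩ := chain_satellite_direction_eq_smul p hc hw hr0 hfloor hshade hk hsat (he k hk).le huV huH hu0
    rw [Submodule.mem_span_singleton]
    exact ⟨u (j (k + 1)), by rw [hdir, smul_smul, mul_inv_cancel₀ hne, one_smul]⟩
  · rw [Submodule.span_le, Set.singleton_subset_iff]
    exact chain_direction_mem_resVertex_of_satellite p hc hw hr0 hfloor hshade hk hsat

end Satellite

/-! ## §2 The D∞ class at `(p, d) = (5, 4)`: TT at every late `(2,1)`-state -/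

section DInf

variable [DecidableEq K]

/-- Degree of a weight vector supported on two letters. [folklore] -/
theorem degree_eq_add_of_forall_ne {f : Fin 4 →₀ ℕ} {a c : Fin 4} (hac : a ≠ c)
    (h : ∀ i, i ≠ a → i ≠ c → f i = 0) : f.degree = f a + f c := by
  classical
  rw [Finsupp.degree_eq_sum, ← Finset.add_sum_erase _ _ (Finset.mem_univ a),
    ← Finset.add_sum_erase _ _ (Finset.mem_erase.mpr ⟨hac.symm, Finset.mem_univ c⟩), Finset.sum_eq_zero, add_zero]
  intro i hi
  obtain ⟨hic, hi'⟩ := Finset.mem_erase.mp hi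
  exact h i (Finset.mem_erase.mp hi').1 hic

/-- The boundary law read at a non-chart letter: kept letters keep their weight, translated letters are lost. [folklore]
[cite: HauserPerlega2019PRIMS, §2 (transform D′ of D)] -/
theorem update_filter_apply_of_ne {f : Fin 4 →₀ ℕ} {β : Fin 4 → K} {a i : Fin 4} {v : ℕ} (hia : i ≠ a) :
    ((f.filter fun l => β l = 0).update a v) i = if β i = 0 then f i else 0 := by
  rw [Finsupp.coe_update, Function.update_of_ne hia, Finsupp.filter_apply]

/-- **A `(2)`-VISIT OF THE D∞ BRANCH**: if `|r_{k+1}| = 2` (`k ≥ k₁`), then `|r_k| = 3`, the heavy letter of `c (k+1)` is the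
newborn `j k` (weight `2`), step `k + 1` is a SATELLITE of step `k` (it neither charts nor translates `j k`), and `c (k+2)` is the
`(2,1)`-state with `r (j k) = 2`, `r (j (k+1)) = 1` and no other boundary letter. [OURS · W₄ bookkeeping]
[cite: CossartJannsenSaito2020, Thm. 3.14] [cite: HauserPerlega2019PRIMS, §2 (transform D′ of D)] -/
theorem dInf_two_visit {c : ℕ → State K} {j : ℕ → Fin 4} {b : ℕ → Fin 4 → K}
    (hc : ∀ k, IsIsolated 5 (c k).F ∧ Step0 5 (c k) (c (k + 1))) (hw : FreeTail.IsWitnessedChain 5 c j b)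
    (hr0 : ∀ e ∈ (c 0).F.support, (c 0).r ≤ e) (hfloor : ∀ k, ordZero (c k).F ≠ (5 : ℕ)) {k₀ : ℕ}
    (hshade : ∀ k, k₀ ≤ k → (c k).shade = ((4 : ℕ) : ℕ∞)) {k₁ : ℕ} (hk₁ : k₀ ≤ k₁)
    (hD : ∀ k, k₁ ≤ k → (∃ W, (c k).r W = 2 ∧ ∀ i, i ≠ W → (c k).r i ≤ 1) ∧
      (2 ≤ (c k).r.degree ∧ (c k).r.degree ≤ 3))
    {k : ℕ} (hk : k₁ ≤ k) (h2 : (c (k + 1)).r.degree = 2) :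
    (c k).r.degree = 3 ∧ (c (k + 1)).r (j k) = 2 ∧ FreeTail.IsSatellite j b k ∧
      (c (k + 2)).r (j k) = 2 ∧ (c (k + 2)).r (j (k + 1)) = 1 ∧ (c (k + 2)).r.degree = 3 ∧
      ∀ i, i ≠ j k → i ≠ j (k + 1) → (c (k + 2)).r i = 0 := by
  have hfloor' : ∀ k, ordZero (c k).F ≠ 5 := fun k => by exact_mod_cast hfloor k
  -- state `k` is a `(2,1)`-state: a `(2)`-state is followed by a state of degree `≥ 3`
  have h3 : (c k).r.degree = 3 := by
    rcases (hD k hk).2 with ⟨h2le, h3le⟩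
    by_contra hne
    obtain ⟨W₀, hW₀, -⟩ := (hD k hk).1
    obtain ⟨hjW, -, hW', hj'⟩ :=
      (dInf_pattern hc hw hr0 hfloor' hshade (show k₀ ≤ k by omega) hW₀).1 (by omega)
    have hle := apply_add_apply_le_degree ((c (k + 1)).r) (a := W₀) (c := j k) (Ne.symm hjW)
    omega
  obtain ⟨W, hW, -⟩ := (hD k hk).1
  obtain ⟨-, hnew⟩ := (dInf_pattern hc hw hr0 hfloor' hshade (show k₀ ≤ k by omega) hW).2.1 h3
  -- step `k + 1` at the `(2)`-state `k + 1`, heavy letter `j k`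
  obtain ⟨hj, hb, hW2, hj1⟩ := (dInf_pattern hc hw hr0 hfloor' hshade (show k₀ ≤ k + 1 by omega) hnew).1 h2
  have hW2' : (c (k + 2)).r (j k) = 2 := hW2
  have hj1' : (c (k + 2)).r (j (k + 1)) = 1 := hj1
  have hle := apply_add_apply_le_degree ((c (k + 2)).r) (Ne.symm hj)
  have h3' : (c (k + 2)).r.degree = 3 := by
    rcases (hD (k + 2) (by omega)).2 with ⟨-, h3le⟩
    omega
  exact ⟨h3, hnew, ⟨hj, hb⟩, hW2', hj1', h3',
    apply_eq_zero_of_degree_eq ((c (k + 2)).r) (Ne.symm hj) (by omega)⟩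

/-- **A `(2,1) → (2,1)` STEP OF THE D∞ BRANCH, bookkeeping**: at a `(2,1)`-state `k ≥ k₁` with heavy letter `W` and light
letter `h` (`r W = 2`, `r h = 1`), if `|r_{k+1}| = 3` then the light letter is neither charted nor translated (`j k ≠ h`,
`b k h = 0`), the heavy letter is hit (`j k = W ∨ b k W ≠ 0`), and `c (k+1)` is the `(2,1)`-state with `r (j k) = 2`,
`r h = 1` and no other boundary letter. [OURS · W₄ bookkeeping]
[cite: CossartJannsenSaito2020, Thm. 3.14] [cite: HauserPerlega2019PRIMS, §2 (transform D′ of D)] -/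
theorem dInf_three_three_step {c : ℕ → State K} {j : ℕ → Fin 4} {b : ℕ → Fin 4 → K}
    (hc : ∀ k, IsIsolated 5 (c k).F ∧ Step0 5 (c k) (c (k + 1))) (hw : FreeTail.IsWitnessedChain 5 c j b)
    (hr0 : ∀ e ∈ (c 0).F.support, (c 0).r ≤ e) (hfloor : ∀ k, ordZero (c k).F ≠ (5 : ℕ)) {k₀ : ℕ}
    (hshade : ∀ k, k₀ ≤ k → (c k).shade = ((4 : ℕ) : ℕ∞)) {k₁ : ℕ} (hk₁ : k₀ ≤ k₁)
    (hD : ∀ k, k₁ ≤ k → (∃ W, (c k).r W = 2 ∧ ∀ i, i ≠ W → (c k).r i ≤ 1) ∧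
      (2 ≤ (c k).r.degree ∧ (c k).r.degree ≤ 3))
    {k : ℕ} (hk : k₁ ≤ k) {W h : Fin 4} (hW : (c k).r W = 2) (hh : (c k).r h = 1)
    (h3' : (c (k + 1)).r.degree = 3) :
    W ≠ h ∧ j k ≠ h ∧ b k h = 0 ∧ (j k = W ∨ b k W ≠ 0) ∧ (c (k + 1)).r (j k) = 2 ∧ (c (k + 1)).r h = 1 ∧
      ∀ i, i ≠ j k → i ≠ h → (c (k + 1)).r i = 0 := by
  have hfloor' : ∀ k, ordZero (c k).F ≠ 5 := fun k => by exact_mod_cast hfloor k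
  obtain ⟨-, hlaw, -, -, -⟩ := four_weights_laws hc hw hr0 hfloor' hshade
  have hl := hlaw k (by omega)
  have hWh : W ≠ h := by rintro rfl; omega
  have h3 : (c k).r.degree = 3 := by
    rcases (hD k hk).2 with ⟨-, h3le⟩
    have hle := apply_add_apply_le_degree ((c k).r) hWh
    omega
  have hzero : ∀ i, i ≠ W → i ≠ h → (c k).r i = 0 :=
    apply_eq_zero_of_degree_eq ((c k).r) hWh (by omega)
  obtain ⟨hhit, hnew⟩ := (dInf_pattern hc hw hr0 hfloor' hshade (show k₀ ≤ k by omega) hW).2.1 h3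
  -- every letter other than the newborn `j k` and the light letter `h` is lost or was already free
  have hothers : ∀ i, i ≠ j k → i ≠ h → (c (k + 1)).r i = 0 := by
    intro i hij hih
    rw [hl, update_filter_apply_of_ne hij]
    by_cases hiW : i = W
    · subst hiW
      rw [if_neg (hhit.resolve_left (Ne.symm hij))]
    · rw [hzero i hiW hih, ite_self]
  -- the light letter is not the chart: else `|r_{k+1}| = 2 + 0`
  have hjh : j k ≠ h := by
    intro hjh
    have hWj : W ≠ j k := fun hWj => hWh (hWj.trans hjh)
    have hdeg := degree_eq_add_of_forall_ne (f := (c (k + 1)).r) (Ne.symm hWj) fun i hij hiW =>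
      hothers i hij (fun hih => hij (hih.trans hjh.symm))
    rw [hnew, hothers W hWj hWh] at hdeg
    omega
  have hdeg := degree_eq_add_of_forall_ne (f := (c (k + 1)).r) hjh hothers
  have hrh : (c (k + 1)).r h = if b k h = 0 then (c k).r h else 0 := by
    rw [hl, update_filter_apply_of_ne (Ne.symm hjh)]
  have hbh : b k h = 0 := by
    by_contra hbh
    rw [if_neg hbh] at hrh
    omega
  rw [if_pos hbh, hh] at hrh
  exact ⟨hWh, hjh, hbh, hhit, hnew, hrh, hothers⟩

/-- **TT PASSES ALONG A `(2,1) → (2,1)` STEP OF THE D∞ BRANCH**: TT for the boundary pair `{W, h}` at a `(2,1)`-state `k`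
(`k₀ ≤ k₁ ≤ k`, constant shade `4`, `e_G ≡ 2`) and `|r_{k+1}| = 3` ⇒ TT for the boundary pair `{j k, h}` of `c (k+1)` — by
`tt_succ` when the chart is the heavy letter, by `tt_move` with the frame vector `D_k / b_k W = e_W + φ`, `φ_{j k} = 1 / b_k W ≠ 0`,
when the chart is a free letter. [OURS] [cite: CossartJannsenSaito2020, Thm. 3.10(4), Thm. 3.14, Thm. 9.3] -/
theorem dInf_tt_succ {c : ℕ → State K} {j : ℕ → Fin 4} {b : ℕ → Fin 4 → K}
    (hc : ∀ k, IsIsolated 5 (c k).F ∧ Step0 5 (c k) (c (k + 1))) (hw : FreeTail.IsWitnessedChain 5 c j b)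
    (hr0 : ∀ e ∈ (c 0).F.support, (c 0).r ≤ e) (hfloor : ∀ k, ordZero (c k).F ≠ (5 : ℕ)) {k₀ : ℕ}
    (hshade : ∀ k, k₀ ≤ k → (c k).shade = ((4 : ℕ) : ℕ∞))
    (he : ∀ k, k₀ ≤ k → Module.finrank K (resVertex (c k)) = 2) {k₁ : ℕ} (hk₁ : k₀ ≤ k₁)
    (hD : ∀ k, k₁ ≤ k → (∃ W, (c k).r W = 2 ∧ ∀ i, i ≠ W → (c k).r i ≤ 1) ∧
      (2 ≤ (c k).r.degree ∧ (c k).r.degree ≤ 3))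
    {k : ℕ} (hk : k₁ ≤ k) {W h : Fin 4} (hW : (c k).r W = 2) (hh : (c k).r h = 1)
    (h3' : (c (k + 1)).r.degree = 3) (hTT : ∀ v ∈ resVertex (c k), v W = 0 → v h = 0 → v = 0) :
    ∀ v ∈ resVertex (c (k + 1)), v (j k) = 0 → v h = 0 → v = 0 := by
  haveI : Fact (Nat.Prime 5) := ⟨by norm_num⟩
  obtain ⟨hWh, hjh, hbh, hhit, -, -, -⟩ := dInf_three_three_step hc hw hr0 hfloor hshade hk₁ hD hk hW hh h3'
  by_cases hjW : j k = W
  · -- chart = heavy letter: TT persists along a pair chart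
    rw [hjW]
    exact tt_succ 5 hc hw hr0 hfloor hshade he (show k₀ ≤ k by omega) hTT (Or.inl hjW)
  · -- chart = a free letter `g := j k`, `b k W ≠ 0`: pair move with the frame vector `D_k / b k W`
    have hbW : b k W ≠ 0 := hhit.resolve_left hjW
    have hDk : direction (j k) (b k) ∈ resVertex (c k) :=
      chain_direction_mem_resVertex 5 hc hw hr0 hfloor hshade (show k₀ ≤ k by omega)
    have hφa : ((b k W)⁻¹ • direction (j k) (b k) - (Pi.single W 1 : Fin 4 → K)) W = 0 := by
      simp only [Pi.sub_apply, Pi.smul_apply, smul_eq_mul, Pi.single_eq_same,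
        direction_apply_of_ne (Ne.symm hjW), inv_mul_cancel₀ hbW, sub_self]
    have hφh : ((b k W)⁻¹ • direction (j k) (b k) - (Pi.single W 1 : Fin 4 → K)) h = 0 := by
      simp only [Pi.sub_apply, Pi.smul_apply, smul_eq_mul, Pi.single_eq_of_ne hWh.symm,
        direction_apply_of_ne (Ne.symm hjh), hbh, mul_zero, sub_zero]
    have hφV : (Pi.single W 1 : Fin 4 → K) + ((b k W)⁻¹ • direction (j k) (b k) - (Pi.single W 1 : Fin 4 → K)) ∈
        resVertex (c k) := by
      rw [add_sub_cancel]
      exact Submodule.smul_mem _ _ hDk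
    have hφg : ((b k W)⁻¹ • direction (j k) (b k) - (Pi.single W 1 : Fin 4 → K)) (j k) ≠ 0 := by
      simp only [Pi.sub_apply, Pi.smul_apply, smul_eq_mul, Pi.single_eq_of_ne hjW, direction_apply_self,
        mul_one, sub_zero]
      exact inv_ne_zero hbW
    exact tt_move 5 hc hw hr0 hfloor hshade he hjW (show k₀ ≤ k by omega) hTT hφa hφh hφV hφg rfl

/-- **TT ALONG A D∞ RUN**: in the D∞ branch (from `k₁ ≥ k₀`, constant shade `4`, `e_G ≡ 2`), after a `(2)`-state `k + 1`
(`k ≥ k₁`) every state of the following run of `(2,1)`-states is TT for its boundary letters: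
`∀ v ∈ resVertex (c m), (∀ i, 1 ≤ (c m).r i → v i = 0) → v = 0` for `k + 2 ≤ m` as long as `|r| = 3` on `[k+2, m]`. [OURS]
[cite: CossartJannsenSaito2020, Thm. 3.10(4), Thm. 3.14, Thm. 9.3] -/
theorem dInf_tt_run {c : ℕ → State K} {j : ℕ → Fin 4} {b : ℕ → Fin 4 → K}
    (hc : ∀ k, IsIsolated 5 (c k).F ∧ Step0 5 (c k) (c (k + 1))) (hw : FreeTail.IsWitnessedChain 5 c j b)
    (hr0 : ∀ e ∈ (c 0).F.support, (c 0).r ≤ e) (hfloor : ∀ k, ordZero (c k).F ≠ (5 : ℕ)) {k₀ : ℕ}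
    (hshade : ∀ k, k₀ ≤ k → (c k).shade = ((4 : ℕ) : ℕ∞))
    (he : ∀ k, k₀ ≤ k → Module.finrank K (resVertex (c k)) = 2) {k₁ : ℕ} (hk₁ : k₀ ≤ k₁)
    (hD : ∀ k, k₁ ≤ k → (∃ W, (c k).r W = 2 ∧ ∀ i, i ≠ W → (c k).r i ≤ 1) ∧
      (2 ≤ (c k).r.degree ∧ (c k).r.degree ≤ 3))
    {k : ℕ} (hk : k₁ ≤ k) (h2 : (c (k + 1)).r.degree = 2) {m : ℕ} (hm : k + 2 ≤ m)
    (hrun : ∀ t, k + 2 ≤ t → t ≤ m → (c t).r.degree = 3) :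
    ∀ v ∈ resVertex (c m), (∀ i, 1 ≤ (c m).r i → v i = 0) → v = 0 := by
  haveI : Fact (Nat.Prime 5) := ⟨by norm_num⟩
  -- the invariant: a boundary pair `{W, h}` of weights `(2, 1)` that is TT
  suffices H : ∀ n, k + 2 + n ≤ m → ∃ W h : Fin 4, (c (k + 2 + n)).r W = 2 ∧ (c (k + 2 + n)).r h = 1 ∧
      ∀ v ∈ resVertex (c (k + 2 + n)), v W = 0 → v h = 0 → v = 0 by
    obtain ⟨n, rfl⟩ := Nat.exists_eq_add_of_le hm
    obtain ⟨W, h, hW, hh, hTT⟩ := H n le_rfl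
    intro v hv hvr
    exact hTT v hv (hvr W (by omega)) (hvr h (by omega))
  intro n
  induction n with
  | zero =>
    intro _
    obtain ⟨-, -, hsat, hW2, hj1, -, -⟩ := dInf_two_visit hc hw hr0 hfloor hshade hk₁ hD hk h2
    exact ⟨j k, j (k + 1), hW2, hj1, tt_of_satellite 5 hc hw hr0 hfloor hshade he (show k₀ ≤ k by omega) hsat⟩
  | succ n ih =>
    intro hn
    obtain ⟨W, h, hW, hh, hTT⟩ := ih (by omega)
    have h3' : (c (k + 2 + n + 1)).r.degree = 3 := hrun (k + 2 + n + 1) (by omega) (by omega)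
    obtain ⟨-, -, -, -, hnew, hh1, -⟩ :=
      dInf_three_three_step hc hw hr0 hfloor hshade hk₁ hD (show k₁ ≤ k + 2 + n by omega) hW hh h3'
    exact ⟨j (k + 2 + n), h, hnew, hh1,
      dInf_tt_succ hc hw hr0 hfloor hshade he hk₁ hD (show k₁ ≤ k + 2 + n by omega) hW hh h3' hTT⟩

/-- **THE D∞ CLASS IS TT AT EVERY LATE `(2,1)`-STATE.**  On a witnessed isolated above-floor `Step0 5` chain with `x^{r₀} ∣ F₀`,
constant shade `4` and `e_G ≡ 2` from `k₀`, in the D∞ branch from `k₁ ≥ k₀` (W₄ `four_weights_dichotomy`, binder verbatim),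
there is `k₂ ≥ k₁` such that at every `m ≥ k₂` with `|r_m| = 3` no non-zero vector of `resVertex (c m)` vanishes on the
boundary letters: `∀ v ∈ resVertex (c m), (∀ i, 1 ≤ (c m).r i → v i = 0) → v = 0`.  (`k₂ = k + 2` for the first `(2)`-state
`k + 1 > k₁`, which exists by W₄'s `(2)`-visit dock; every later `(2,1)`-state ends a `(2,1)`-run begun at a `(2)`-state.)
No entry hypothesis, no FT. [OURS] [cite: CossartJannsenSaito2020, Thm. 3.10(4), Thm. 3.14, Thm. 9.3] -/
theorem dInf_tt [CharP K 5] {c : ℕ → State K} {j : ℕ → Fin 4} {b : ℕ → Fin 4 → K}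
    (hc : ∀ k, IsIsolated 5 (c k).F ∧ Step0 5 (c k) (c (k + 1))) (hw : FreeTail.IsWitnessedChain 5 c j b)
    (hr0 : ∀ e ∈ (c 0).F.support, (c 0).r ≤ e) (hfloor : ∀ k, ordZero (c k).F ≠ (5 : ℕ)) (k₀ : ℕ)
    (hshade : ∀ k, k₀ ≤ k → (c k).shade = ((4 : ℕ) : ℕ∞))
    (he : ∀ k, k₀ ≤ k → Module.finrank K (resVertex (c k)) = 2) (k₁ : ℕ) (hk₁ : k₀ ≤ k₁)
    (hD : ∀ k, k₁ ≤ k → (∃ W, (c k).r W = 2 ∧ ∀ i, i ≠ W → (c k).r i ≤ 1) ∧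
      (2 ≤ (c k).r.degree ∧ (c k).r.degree ≤ 3)) :
    ∃ k₂, k₁ ≤ k₂ ∧ ∀ m, k₂ ≤ m → (c m).r.degree = 3 →
      ∀ v ∈ resVertex (c m), (∀ i, 1 ≤ (c m).r i → v i = 0) → v = 0 := by
  haveI : Fact (Nat.Prime 5) := ⟨by norm_num⟩
  classical
  have hfloor' : ∀ k, ordZero (c k).F ≠ 5 := fun k => by exact_mod_cast hfloor k
  -- a first `(2)`-state `k + 1` with `k ≥ k₁` (the `(2)`-visit dock with budget `0`)
  have hex : ∃ k, k₁ ≤ k ∧ (c (k + 1)).r.degree = 2 := by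
    by_contra hno
    push Not at hno
    refine no_four_tail_of_degree_two_budget hc hw hr0 hfloor' hshade (k₁ := k₁ + 1) (by omega) (B := 0) fun n => ?_
    rw [Nat.le_zero, Finset.card_eq_zero, Finset.filter_eq_empty_iff]
    intro i _
    rw [show k₁ + 1 + i = k₁ + i + 1 by ring]
    exact hno (k₁ + i) (by omega)
  obtain ⟨k, hk, h2⟩ := hex
  refine ⟨k + 2, by omega, fun m hm h3 => ?_⟩
  -- the last `(2)`-state `t ≤ m` with `t ≥ k + 1` (it is `< m` since `|r_m| = 3`)
  have hS : ((Finset.range (m + 1)).filter (fun t => k + 1 ≤ t ∧ (c t).r.degree = 2)).Nonempty :=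
    ⟨k + 1, Finset.mem_filter.mpr ⟨Finset.mem_range.mpr (by omega), le_rfl, h2⟩⟩
  obtain ⟨t, ht⟩ : ∃ t, t = ((Finset.range (m + 1)).filter (fun t => k + 1 ≤ t ∧ (c t).r.degree = 2)).max' hS :=
    ⟨_, rfl⟩
  have htmem := Finset.max'_mem _ hS
  rw [← ht, Finset.mem_filter, Finset.mem_range] at htmem
  obtain ⟨htm, hkt, ht2⟩ := htmem
  have htm' : t < m := by
    rcases Nat.lt_or_ge t m with h | h
    · exact h
    · have : t = m := by omega
      rw [this] at ht2; omega
  have hrun : ∀ s, t + 1 ≤ s → s ≤ m → (c s).r.degree = 3 := by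
    intro s hs hsm
    rcases (hD s (by omega)).2 with ⟨h2le, h3le⟩
    by_contra hne
    have hsmem : s ∈ (Finset.range (m + 1)).filter (fun t => k + 1 ≤ t ∧ (c t).r.degree = 2) :=
      Finset.mem_filter.mpr ⟨Finset.mem_range.mpr (by omega), by omega, by omega⟩
    have := Finset.le_max' _ s hsmem
    rw [← ht] at this
    omega
  have ht1 : t - 1 + 1 = t := by omega
  have ht2' : (c (t - 1 + 1)).r.degree = 2 := by rw [ht1]; exact ht2
  exact dInf_tt_run hc hw hr0 hfloor hshade he hk₁ hD (k := t - 1) (by omega) ht2' (m := m) (by omega)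
    (fun s hs hsm => hrun s (by omega) hsm)

end DInf

end ResCone

end Summit.ResolutionOfSingularities.ResolutionOfSingularities.Theorems.PIDim4

end
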